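import Summits.Ventures.PercRepro.Night2FatXFreePoint
import Summits.Ventures.PercRepro.Night2FatXDistOne

/-!
# night-2: the fat case when the loads sit at level `2` only — `N ≥ 6`; no four collinear points with generic
# off-points, `|G| ≥ 12`

When every loaded target above `Q ∪ {x}` has exactly two points off `Q` (level `2`), the levels `1, 3, 4, 5, 6` of the
binomial criterion suffice for `N ≥ 6`: `110/221 + (180/221)(10/15 + 10/35 + 5/70 + 1/126) = 1.337` at `N = 6` and
`110/221 + 15·(110/221)/15 + 20·(110/221)/35 = 1.28` with the `11/18` floors for `N ≥ 7` (`fat_count_numeric_level_two`):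
**`basis_pair_fair_fat_of_level_two_loads`**.  With no four collinear points off `K` a distance-1 load has a line of
`|Y| + 2 ≤ 3` points, so `|Y| = 1` — level `2` — and with generic off-points there is no distance-2 load
(`level_two_of_dload_ne_zero_of_lines_le_three_of_generic`).  Hence
**`localShadowHall_fat_of_lines_le_three_of_generic`**: the (2,1) cell with a fat closure, no four collinear points off `K`,
generic off-points and `|G| ≥ 12` (the case `|G| = 10` is `localShadowHall_fat_of_card_eq_ten`; `|G| ≥ 13` needs no
genericity: `localShadowHall_fat_of_lines_le_three`).  Paper `proofs/NIGHT-2-g33.md` §6 (e).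
-/

namespace PercRepro.Shadow

open PercRepro.ThmH PercRepro.PerFlat

variable {α : Type*} [DecidableEq α] {M : Matroid α} [M.Finite] {G : Finset α}

/-- The fat count sum dominates the sum of its levels `1, 3, 4, 5, 6`. -/
theorem fat_count_sum_ge_levels_one_three_to_six (hG : G ∈ flatsQ M (5 + 1)) (hd : (gr M \ G).card = 2)
    {B : Finset α} {z : α} {x : α} :
    (∑ j ∈ ({1, 3, 4, 5, 6} : Finset ℕ), ∑ T ∈ ((tgtSets M 5 G B z).filter
        (fun T => x ∈ T ∧ dload M 5 G (bigP M G) (dshGT2 M 5 G) T = 0)).filter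
        (fun T => (T \ insert z B).card = j),
        capS M 5 G T / ((221 / 360 : ℚ) * ((2 * ((T \ coloops M G).card - 2).choose 4 : ℕ) : ℚ))) ≤
    ∑ T ∈ (tgtSets M 5 G B z).filter
        (fun T => x ∈ T ∧ dload M 5 G (bigP M G) (dshGT2 M 5 G) T = 0),
        capS M 5 G T / ((221 / 360 : ℚ) * ((2 * ((T \ coloops M G).card - 2).choose 4 : ℕ) : ℚ)) := by
  have hd' : (gr M \ G).card ≤ 5 := by omega
  set F := (tgtSets M 5 G B z).filter
    (fun T => x ∈ T ∧ dload M 5 G (bigP M G) (dshGT2 M 5 G) T = 0) with hF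
  set f : Finset α → ℚ := fun T =>
    capS M 5 G T / ((221 / 360 : ℚ) * ((2 * ((T \ coloops M G).card - 2).choose 4 : ℕ) : ℚ)) with hf
  have hf0 : ∀ T ∈ F, 0 ≤ f T := fun T _ => div_nonneg (capS_nonneg' hG hd' T) (by positivity)
  set J : Finset ℕ := {1, 3, 4, 5, 6} with hJ
  have hfib := Finset.sum_fiberwise_of_maps_to (s := F.filter (fun T => (T \ insert z B).card ∈ J)) (t := J)
    (g := fun T => (T \ insert z B).card) (f := f) (fun T hT => (Finset.mem_filter.1 hT).2)
  have hinner : ∀ j ∈ J, (F.filter (fun T => (T \ insert z B).card ∈ J)).filter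
      (fun T => (T \ insert z B).card = j) = F.filter (fun T => (T \ insert z B).card = j) := by
    intro j hj
    ext T
    simp only [Finset.mem_filter]
    constructor
    · rintro ⟨⟨h1, -⟩, h2⟩
      exact ⟨h1, h2⟩
    · rintro ⟨h1, h2⟩
      exact ⟨⟨h1, h2 ▸ hj⟩, h2⟩
  calc ∑ j ∈ J, ∑ T ∈ F.filter (fun T => (T \ insert z B).card = j), f T
      = ∑ j ∈ J, ∑ T ∈ (F.filter (fun T => (T \ insert z B).card ∈ J)).filter
          (fun T => (T \ insert z B).card = j), f T := by
        apply Finset.sum_congr rfl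
        intro j hj
        rw [hinner j hj]
    _ = ∑ T ∈ F.filter (fun T => (T \ insert z B).card ∈ J), f T := hfib
    _ ≤ ∑ T ∈ F, f T := by
        apply Finset.sum_le_sum_of_subset_of_nonneg (Finset.filter_subset _ _)
        intro T hT _
        exact hf0 T hT

/-- **The numerical core for loads at level `2` only**: for `N ≥ 6` the levels `1, 3, 4, 5, 6` give at least `1`. -/
theorem fat_count_numeric_level_two (N : ℕ) (hN : 6 ≤ N) :
    (1 : ℚ) ≤ (((N - 1).choose 0 : ℕ) : ℚ) * fatTerm 1 (if N - 1 ≤ 3 then 1 else 11 / 18) +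
      ((((N - 1).choose 2 : ℕ) : ℚ) * fatTerm 3 (if N - 3 ≤ 3 then 1 else 11 / 18) +
      (((N - 1).choose 3 : ℕ) : ℚ) * fatTerm 4 (if N - 4 ≤ 3 then 1 else 11 / 18) +
      (((N - 1).choose 4 : ℕ) : ℚ) * fatTerm 5 (if N - 5 ≤ 3 then 1 else 11 / 18) +
      (((N - 1).choose 5 : ℕ) : ℚ) * fatTerm 6 (if N - 6 ≤ 3 then 1 else 11 / 18)) := by
  unfold fatTerm
  rcases Nat.lt_or_ge N 7 with h7 | h7
  · interval_cases N
    norm_num [Nat.choose]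
  · have hc0 : (((N - 1).choose 0 : ℕ) : ℚ) = 1 := by simp
    have h15 : (15 : ℚ) ≤ (((N - 1).choose 2 : ℕ) : ℚ) := by
      have : (6 : ℕ).choose 2 ≤ (N - 1).choose 2 := Nat.choose_le_choose 2 (by omega)
      have h : (6 : ℕ).choose 2 = 15 := by decide
      exact_mod_cast (h ▸ this)
    have h20 : (20 : ℚ) ≤ (((N - 1).choose 3 : ℕ) : ℚ) := by
      have : (6 : ℕ).choose 3 ≤ (N - 1).choose 3 := Nat.choose_le_choose 3 (by omega)
      have h : (6 : ℕ).choose 3 = 20 := by decide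
      exact_mod_cast (h ▸ this)
    have hif : ∀ k : ℕ, (if N - k ≤ 3 then (1 : ℚ) else 11 / 18) ≥ 11 / 18 := by
      intro k
      split_ifs <;> norm_num
    rw [hc0]
    have h1 : (11 / 18 : ℚ) / ((221 / 360 : ℚ) * ((2 * (1 + 3).choose 4 : ℕ) : ℚ)) ≤
        1 * ((if N - 1 ≤ 3 then (1 : ℚ) else 11 / 18) / ((221 / 360 : ℚ) * ((2 * (1 + 3).choose 4 : ℕ) : ℚ))) := by
      rw [one_mul]
      apply div_le_div_of_nonneg_right (hif 1)
      positivity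
    have h3 : (15 : ℚ) * ((11 / 18 : ℚ) / ((221 / 360 : ℚ) * ((2 * (3 + 3).choose 4 : ℕ) : ℚ))) ≤
        (((N - 1).choose 2 : ℕ) : ℚ) * ((if N - 3 ≤ 3 then (1 : ℚ) else 11 / 18) /
          ((221 / 360 : ℚ) * ((2 * (3 + 3).choose 4 : ℕ) : ℚ))) := by
      apply mul_le_mul h15 (div_le_div_of_nonneg_right (hif 3) (by positivity)) (by positivity) (Nat.cast_nonneg _)
    have h4 : (20 : ℚ) * ((11 / 18 : ℚ) / ((221 / 360 : ℚ) * ((2 * (4 + 3).choose 4 : ℕ) : ℚ))) ≤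
        (((N - 1).choose 3 : ℕ) : ℚ) * ((if N - 4 ≤ 3 then (1 : ℚ) else 11 / 18) /
          ((221 / 360 : ℚ) * ((2 * (4 + 3).choose 4 : ℕ) : ℚ))) := by
      apply mul_le_mul h20 (div_le_div_of_nonneg_right (hif 4) (by positivity)) (by positivity) (Nat.cast_nonneg _)
    have h5 : (0 : ℚ) ≤ (((N - 1).choose 4 : ℕ) : ℚ) * ((if N - 5 ≤ 3 then (1 : ℚ) else 11 / 18) /
        ((221 / 360 : ℚ) * ((2 * (5 + 3).choose 4 : ℕ) : ℚ))) := by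
      apply mul_nonneg (Nat.cast_nonneg _)
      apply div_nonneg (le_trans (by norm_num) (hif 5))
      positivity
    have h6 : (0 : ℚ) ≤ (((N - 1).choose 5 : ℕ) : ℚ) * ((if N - 6 ≤ 3 then (1 : ℚ) else 11 / 18) /
        ((221 / 360 : ℚ) * ((2 * (6 + 3).choose 4 : ℕ) : ℚ))) := by
      apply mul_nonneg (Nat.cast_nonneg _)
      apply div_nonneg (le_trans (by norm_num) (hif 6))
      positivity
    have hnum : (1 : ℚ) ≤ (11 / 18 : ℚ) / ((221 / 360 : ℚ) * ((2 * (1 + 3).choose 4 : ℕ) : ℚ)) +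
        ((15 : ℚ) * ((11 / 18 : ℚ) / ((221 / 360 : ℚ) * ((2 * (3 + 3).choose 4 : ℕ) : ℚ))) +
        (20 : ℚ) * ((11 / 18 : ℚ) / ((221 / 360 : ℚ) * ((2 * (4 + 3).choose 4 : ℕ) : ℚ)))) := by
      norm_num [Nat.choose]
    linarith

/-- **The fat case of (FAIR) when the loads sit at level `2` only and `N ≥ 6`.** -/
theorem basis_pair_fair_fat_of_level_two_loads (hG : G ∈ flatsQ M (5 + 1)) (hd : (gr M \ G).card = 2)
    (hk : kColoops M G = 1) (hs : ∀ e ∈ gr M, ∀ f ∈ gr M, e ≠ f → rkN M {e, f} = 2)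
    (hl : ∀ e ∈ gr M, M.Indep {e}) (hfat : (fatClosures M 5 G 2).card ≤ 1)
    {B₀ : Finset α} (hB₀ : B₀ ∈ thinMembers M 5 G) {w₀ x : α} (hD : G \ clF M B₀ = {w₀, x}) (hne : w₀ ≠ x)
    {B : Finset α} (hB : B ∈ thinMembers M 5 G) (hnP : ¬ bigP M G B) {z : α} (hz : z ∈ G \ clF M B)
    (hl0 : loss M 5 G B z ≠ 0) (hw₀ : w₀ ∈ insert z B) (hx : x ∉ insert z B) (hN : 6 ≤ (G \ insert z B).card)
    (hload : ∀ T ∈ tgtSets M 5 G B z, x ∈ T → (T \ insert z B).card ≠ 2 →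
      dload M 5 G (bigP M G) (dshGT2 M 5 G) T = 0) :
    loss M 5 G B z ≤ rhoL M 5 G B z * lossIncomeH M 5 G (bigP M G) (dshGT2 M 5 G) B z := by
  have hxG : x ∈ G \ insert z B := by
    refine Finset.mem_sdiff.2 ⟨?_, hx⟩
    have : x ∈ G \ clF M B₀ := by
      rw [hD]
      exact Finset.mem_insert_of_mem (Finset.mem_singleton_self _)
    exact (Finset.mem_sdiff.1 this).1
  apply basis_pair_fair_of_fat_count_sum hG hd hk hs hl hfat hB₀ hD hne hB hnP hz hl0 hw₀ hx
  have hl1 := fat_count_level_ge' hG hd hk hB hnP hz hxG (j := 1) (by norm_num)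
    (fun T hT hxT h1 => hload T hT hxT (by omega))
  have hl3 := fat_count_level_ge' hG hd hk hB hnP hz hxG (j := 3) (by norm_num)
    (fun T hT hxT h3 => hload T hT hxT (by omega))
  have hl4 := fat_count_level_ge' hG hd hk hB hnP hz hxG (j := 4) (by norm_num)
    (fun T hT hxT h4 => hload T hT hxT (by omega))
  have hl5 := fat_count_level_ge' hG hd hk hB hnP hz hxG (j := 5) (by norm_num)
    (fun T hT hxT h5 => hload T hT hxT (by omega))
  have hl6 := fat_count_level_ge' hG hd hk hB hnP hz hxG (j := 6) (by norm_num)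
    (fun T hT hxT h6 => hload T hT hxT (by omega))
  have hlev := fat_count_sum_ge_levels_one_three_to_six hG hd (B := B) (z := z) (x := x)
  have hnum := fat_count_numeric_level_two (G \ insert z B).card hN
  rw [Finset.sum_insert (by decide), Finset.sum_insert (by decide), Finset.sum_insert (by decide),
    Finset.sum_insert (by decide), Finset.sum_singleton] at hlev
  simp only [Nat.sub_self] at hl1 hl3 hl4 hl5 hl6
  linarith

/-- **With no four collinear points off `K` and generic off-points, a loaded target above `Q ∪ {x}` is at level `2`.** -/
theorem level_two_of_dload_ne_zero_of_lines_le_three_of_generic (hG : G ∈ flatsQ M (5 + 1))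
    (hd : (gr M \ G).card = 2) (hk : kColoops M G = 1)
    (hs : ∀ e ∈ gr M, ∀ f ∈ gr M, e ≠ f → rkN M {e, f} = 2) (hl : ∀ e ∈ gr M, M.Indep {e})
    (hfat : (fatClosures M 5 G 2).card ≤ 1) {B₀ : Finset α} (hB₀ : B₀ ∈ thinMembers M 5 G) {w₀ x : α}
    (hD : G \ clF M B₀ = {w₀, x})
    (htri : ∀ R ⊆ G \ coloops M G, rkN M R = 2 → R.card ≤ 3)
    (hgen : ∀ R ⊆ G \ coloops M G, rkN M R = 2 → 3 ≤ R.card → 4 ≤ rkN M (insert w₀ (insert x R)))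
    {B : Finset α} (hB : B ∈ thinMembers M 5 G) (hnP : ¬ bigP M G B) {z : α} (hz : z ∈ G \ clF M B)
    {T : Finset α} (hT : T ∈ tgtSets M 5 G B z) (hload : dload M 5 G (bigP M G) (dshGT2 M 5 G) T ≠ 0) :
    (T \ insert z B).card = 2 := by
  have hTG : T ⊆ G := subset_G_of_mem_shadowAt (mem_tgtSets.1 hT).1
  have hlev := card_sdiff_coloops_eq_level_add_five hG hd hk hB hnP hz hT
  obtain ⟨R, hR, hR2, hR3, hcase⟩ := loaded_fat_target_dichotomy hG hd hk hs hl hfat hB₀ hD hTG hload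
  have hRV : R ⊆ G \ coloops M G := fun r hr =>
    Finset.sdiff_subset_sdiff hTG (Finset.Subset.refl _) (Finset.mem_sdiff.1 (hR hr)).1
  have h3 := htri R hRV hR2
  rcases hcase with ⟨hRc, -⟩ | ⟨-, hcop⟩
  · omega
  · have := hgen R hRV hR2 hR3
    omega

/-- **The (2,1) cell with a fat closure, no four collinear points off `K`, generic off-points and `|G| ≥ 12`.** -/
theorem localShadowHall_fat_of_lines_le_three_of_generic (hG : G ∈ flatsQ M (5 + 1)) (hd : (gr M \ G).card = 2)
    (hk : kColoops M G = 1) (hs : ∀ e ∈ gr M, ∀ f ∈ gr M, e ≠ f → rkN M {e, f} = 2)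
    (hl : ∀ e ∈ gr M, M.Indep {e}) (hfat : (fatClosures M 5 G 2).card ≤ 1)
    {B₀ : Finset α} (hB₀ : B₀ ∈ thinMembers M 5 G) (hm₀ : (G \ clF M B₀).card = 2)
    (htri : ∀ R ⊆ G \ coloops M G, rkN M R = 2 → R.card ≤ 3)
    (hgen : ∀ R ⊆ G \ coloops M G, rkN M R = 2 → 3 ≤ R.card → 4 ≤ rkN M (R ∪ (G \ clF M B₀)))
    (hG12 : 12 ≤ G.card) : LocalShadowHall M 5 G := by
  apply localShadowHall_of_gt2_of_basis_fair hG hd hk hs hl hfat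
  intro B hB hnP z hz
  have hd' : (gr M \ G).card ≤ 5 := by omega
  by_cases hl0 : loss M 5 G B z = 0
  · rw [hl0]
    have h1 : 0 ≤ rhoL M 5 G B z := by
      unfold rhoL
      rw [hl0]
      simp
    have h2 : 0 ≤ lossIncomeH M 5 G (bigP M G) (dshGT2 M 5 G) B z :=
      lossIncomeH_nonneg hG hd' (column_side_gt2 hG hd hk hs hl hfat) B z
    positivity
  · obtain ⟨w₀, x, hD, hne, hw₀, hx⟩ := exists_fat_split hG hd hk hB₀ hm₀ hB hz hl0
    have hgen' : ∀ R ⊆ G \ coloops M G, rkN M R = 2 → 3 ≤ R.card → 4 ≤ rkN M (insert w₀ (insert x R)) := by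
      intro R hR hR2 hR3
      have := hgen R hR hR2 hR3
      rw [hD] at this
      have heq : R ∪ ({w₀, x} : Finset α) = insert w₀ (insert x R) := by
        ext e
        simp only [Finset.mem_union, Finset.mem_insert, Finset.mem_singleton]
        tauto
      rw [heq] at this
      exact this
    have hN : 6 ≤ (G \ insert z B).card := by
      have hQG : insert z B ⊆ G :=
        Finset.insert_subset (Finset.mem_sdiff.1 hz).1 (subset_G_of_mem_thinMembers hB)
      have hKQ : coloops M G ⊆ insert z B :=
        (coloops_subset_of_mem_thinMembers hG hd' hB).trans (Finset.subset_insert _ _)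
      have hQ5 := card_insert_sdiff_eq_five hG hd hk hB hnP hz
      have h1 := Finset.card_sdiff_add_card_eq_card hKQ
      rw [← kColoops_eq_card_coloops, hk, hQ5] at h1
      have h2 := Finset.card_sdiff_add_card_eq_card hQG
      omega
    refine basis_pair_fair_fat_of_level_two_loads hG hd hk hs hl hfat hB₀ hD hne hB hnP hz hl0 hw₀ hx hN ?_
    intro T hT _ h2
    by_contra hne'
    exact h2 (level_two_of_dload_ne_zero_of_lines_le_three_of_generic hG hd hk hs hl hfat hB₀ hD htri hgen'
      hB hnP hz hT hne')

end PercRepro.Shadow
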